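import Literature.MathematicalPhysics.StatisticalMechanics.LennardJonesClusters
import Literature.Geometry.DiscreteGeometry.TwoShellPatterns

/-!
# Decaying shell sum (stub `stub_tail` of the line `Sketch` for the crux `FarFieldGapR`)

In a `δ`-separated configuration `x` in `ℝ³`, the particles of a set `T` all at distance `≥ R`
(`R ≥ δ > 0`) from `x i` contribute at most `250 δ⁻³ R⁻³` to `∑_{j ∈ T} |xᵢ - xⱼ|⁻⁶`.

This is the tree's shell sum `sum_inv_pow_six_le` with shells of width `R` and the packing count
at scale `δ`: with `m j = ⌊|xᵢ - xⱼ| / R⌋ ≥ 1` on `T`, termwise `|xᵢ - xⱼ|⁻⁶ ≤ (R m_j)⁻⁶`; the shell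
`m = b` lies in the ball of radius `(b + 1) R` about `x i` and is `δ`-separated, so by
`card_le_of_separated_of_dist_le` it holds at most `(2 (b + 1) R / δ + 1)³ ≤ (5 b R / δ)³` particles
(`b ≥ 1`, `R / δ ≥ 1`); per shell this gives `125 δ⁻³ R⁻³ b⁻³ ≤ 125 δ⁻³ R⁻³ b⁻²`, and
`∑_{b ≥ 1} b⁻² ≤ 2` (`sum_Ioo_inv_sq_le`).
-/

noncomputable section

open scoped BigOperators

namespace Summit.AtomisticToContinuum.Crystallization.Theorems.PhononSlackCertificatesFarFieldGapR

open Literature.MathematicalPhysics.StatisticalMechanics Literature.Geometry.DiscreteGeometry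
open Module

/-- Per-shell numerics: for `β ≥ 1` and `0 < δ ≤ R`,
`(2 (β + 1) R / δ + 1)³ · R⁻⁶ β⁻⁶ ≤ 125 δ⁻³ R⁻³ β⁻²`. -/
private theorem tail_shell_numerics {δ R β : ℝ} (hδ : 0 < δ) (hδR : δ ≤ R) (hβ : 1 ≤ β) :
    (2 * ((β + 1) * R) / δ + 1) ^ 3 * (R⁻¹ ^ 6 * β⁻¹ ^ 6) ≤
      125 * (δ⁻¹ ^ 3 * R⁻¹ ^ 3) * (β ^ 2)⁻¹ := by
  have hR : 0 < R := hδ.trans_le hδR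
  have hβ0 : 0 < β := one_pos.trans_le hβ
  have hρ : 1 ≤ R / δ := (one_le_div hδ).2 hδR
  have h5 : 2 * ((β + 1) * R) / δ + 1 ≤ 5 * β * (R / δ) := by
    have : 2 * ((β + 1) * R) / δ = (2 * β + 2) * (R / δ) := by ring
    rw [this]
    nlinarith
  have h5' : (2 * ((β + 1) * R) / δ + 1) ^ 3 ≤ (5 * β * (R / δ)) ^ 3 :=
    pow_le_pow_left₀ (by positivity) h5 3
  have h6 : β⁻¹ ^ 3 ≤ (β ^ 2)⁻¹ := by
    rw [← inv_pow]
    exact pow_le_pow_of_le_one (inv_nonneg.2 hβ0.le) (inv_le_one_of_one_le₀ hβ) (by norm_num)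
  have hδ0 : δ ≠ 0 := hδ.ne'
  have hR0 : R ≠ 0 := hR.ne'
  have hβ0' : β ≠ 0 := hβ0.ne'
  calc (2 * ((β + 1) * R) / δ + 1) ^ 3 * (R⁻¹ ^ 6 * β⁻¹ ^ 6)
      ≤ (5 * β * (R / δ)) ^ 3 * (R⁻¹ ^ 6 * β⁻¹ ^ 6) :=
        mul_le_mul_of_nonneg_right h5' (by positivity)
    _ = 125 * (δ⁻¹ ^ 3 * R⁻¹ ^ 3) * β⁻¹ ^ 3 := by
        field_simp
        ring
    _ ≤ 125 * (δ⁻¹ ^ 3 * R⁻¹ ^ 3) * (β ^ 2)⁻¹ :=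
        mul_le_mul_of_nonneg_left h6 (by positivity)

/-- **Decaying shell sum.** In a `δ`-separated configuration `x` in `ℝ³` (`δ > 0`), for every
particle `i`, every radius `R ≥ δ` and every set `T` of particles at distance `≥ R` from `x i`,
`∑_{j ∈ T} |xᵢ - xⱼ|⁻⁶ ≤ 250 δ⁻³ R⁻³`: the shell `⌊|xᵢ - xⱼ| / R⌋ = b` (`b ≥ 1`) holds at most
`(2 (b + 1) R / δ + 1)³ ≤ (5 b R / δ)³` particles by the packing bound
`card_le_of_separated_of_dist_le`, each contributing `≤ (b R)⁻⁶`, and `∑_{b ≥ 1} b⁻² ≤ 2`. -/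
theorem stub_tail :
    ∀ (N : ℕ) (x : Fin N → EuclideanSpace ℝ (Fin 3)) (δ R : ℝ), 0 < δ → δ ≤ R →
      (∀ i j : Fin N, i ≠ j → δ ≤ dist (x i) (x j)) →
      ∀ (i : Fin N) (T : Finset (Fin N)), (∀ j ∈ T, R ≤ dist (x i) (x j)) →
        ∑ j ∈ T, (dist (x i) (x j))⁻¹ ^ 6 ≤ 250 * (δ⁻¹ ^ 3 * R⁻¹ ^ 3) := by
  intro N x δ R hδ hδR hsep i T hT
  have hR : 0 < R := hδ.trans_le hδR
  set m : Fin N → ℕ := fun k => ⌊dist (x i) (x k) / R⌋₊ with hm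
  set t := T.image m with ht_def
  have hmem : ∀ k ∈ T, m k ∈ t := fun k hk => Finset.mem_image_of_mem m hk
  have hm1 : ∀ k ∈ T, 1 ≤ m k := fun k hk =>
    (Nat.one_le_floor_iff _).2 ((one_le_div hR).2 (hT k hk))
  have hmle : ∀ k ∈ T, R * m k ≤ dist (x i) (x k) := fun k hk => by
    have := Nat.floor_le (div_nonneg dist_nonneg hR.le : 0 ≤ dist (x i) (x k) / R)
    rwa [le_div_iff₀ hR, mul_comm] at this
  have hmlt : ∀ k ∈ T, dist (x i) (x k) < (m k + 1) * R := fun k _ => by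
    have := Nat.lt_floor_add_one (dist (x i) (x k) / R)
    rwa [div_lt_iff₀ hR] at this
  -- termwise: `|xᵢ - x_k|⁻⁶ ≤ (R m_k)⁻⁶`
  have step1 : ∑ k ∈ T, (dist (x i) (x k))⁻¹ ^ 6 ≤ ∑ k ∈ T, R⁻¹ ^ 6 * ((m k : ℝ))⁻¹ ^ 6 := by
    refine Finset.sum_le_sum fun k hk => ?_
    rw [← mul_pow, ← mul_inv]
    have h0 : 0 < R * m k := mul_pos hR (by exact_mod_cast hm1 k hk)
    exact pow_le_pow_left₀ (inv_nonneg.2 dist_nonneg) (inv_anti₀ h0 (hmle k hk)) _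
  -- regroup by shells
  have step2 : ∑ k ∈ T, R⁻¹ ^ 6 * ((m k : ℝ))⁻¹ ^ 6 =
      ∑ b ∈ t, ((T.filter fun k => m k = b).card : ℝ) * (R⁻¹ ^ 6 * ((b : ℝ))⁻¹ ^ 6) := by
    have := Finset.sum_fiberwise_of_maps_to' hmem (fun b : ℕ => R⁻¹ ^ 6 * ((b : ℝ))⁻¹ ^ 6)
    simp only [Finset.sum_const, nsmul_eq_mul] at this
    exact this.symm
  -- each shell holds at most `(2 (b + 1) R / δ + 1)³` particles
  have step3 : ∀ b ∈ t,
      ((T.filter fun k => m k = b).card : ℝ) ≤ (2 * (((b : ℝ) + 1) * R) / δ + 1) ^ 3 := by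
    intro b _
    set F := T.filter fun k => m k = b with hF
    have hinj : Set.InjOn x F := fun k _ l _ hkl => by
      by_contra hne
      have := hsep k l hne
      rw [hkl, dist_self] at this
      exact absurd this (not_le.2 hδ)
    rw [← Finset.card_image_of_injOn hinj]
    have hR' : (0 : ℝ) ≤ ((b : ℝ) + 1) * R := by positivity
    have := card_le_of_separated_of_dist_le (F.image x) (x i) hδ hR' ?_ ?_
    · rwa [finrank_euclideanSpace_fin] at this
    · intro c hc
      obtain ⟨k, hk, rfl⟩ := Finset.mem_image.1 hc
      obtain ⟨hks', hkb⟩ := Finset.mem_filter.1 hk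
      rw [dist_comm]
      have := hmlt k hks'
      rw [hkb] at this
      exact this.le
    · intro c hc c' hc' hne
      obtain ⟨k, -, rfl⟩ := Finset.mem_image.1 hc
      obtain ⟨l, -, rfl⟩ := Finset.mem_image.1 hc'
      exact hsep k l fun h => hne (h ▸ rfl)
  -- numerics per shell: `(2 (b + 1) R / δ + 1)³ R⁻⁶ b⁻⁶ ≤ 125 δ⁻³ R⁻³ b⁻²` for `b ≥ 1`
  have step4 : ∀ b ∈ t, (2 * (((b : ℝ) + 1) * R) / δ + 1) ^ 3 * (R⁻¹ ^ 6 * ((b : ℝ))⁻¹ ^ 6) ≤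
      125 * (δ⁻¹ ^ 3 * R⁻¹ ^ 3) * ((b : ℝ) ^ 2)⁻¹ := by
    intro b hb
    obtain ⟨k, hk, rfl⟩ := Finset.mem_image.1 hb
    have hb1 : (1 : ℝ) ≤ (m k : ℝ) := by exact_mod_cast hm1 k hk
    exact tail_shell_numerics hδ hδR hb1
  -- `∑_{b ∈ t} b⁻² ≤ 2`
  have step5 : ∑ b ∈ t, ((b : ℝ) ^ 2)⁻¹ ≤ 2 := by
    have hsub : t ⊆ Finset.Ioo 0 (t.sup id + 1) := fun b hb => by
      rw [Finset.mem_Ioo]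
      obtain ⟨k, hk, rfl⟩ := Finset.mem_image.1 hb
      exact ⟨hm1 k hk, Nat.lt_succ_of_le (Finset.le_sup (f := id) hb)⟩
    have h2 := sum_Ioo_inv_sq_le (α := ℝ) 0 (t.sup id + 1)
    calc ∑ b ∈ t, ((b : ℝ) ^ 2)⁻¹ ≤ ∑ b ∈ Finset.Ioo 0 (t.sup id + 1), ((b : ℝ) ^ 2)⁻¹ :=
          Finset.sum_le_sum_of_subset_of_nonneg hsub fun b _ _ => by positivity
      _ ≤ 2 := by simpa using h2
  have hC : 0 ≤ δ⁻¹ ^ 3 * R⁻¹ ^ 3 := by positivity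
  calc ∑ k ∈ T, (dist (x i) (x k))⁻¹ ^ 6
      ≤ ∑ b ∈ t, ((T.filter fun k => m k = b).card : ℝ) * (R⁻¹ ^ 6 * ((b : ℝ))⁻¹ ^ 6) :=
        step1.trans_eq step2
    _ ≤ ∑ b ∈ t, (2 * (((b : ℝ) + 1) * R) / δ + 1) ^ 3 * (R⁻¹ ^ 6 * ((b : ℝ))⁻¹ ^ 6) :=
        Finset.sum_le_sum fun b hb => mul_le_mul_of_nonneg_right (step3 b hb) (by positivity)
    _ ≤ ∑ b ∈ t, 125 * (δ⁻¹ ^ 3 * R⁻¹ ^ 3) * ((b : ℝ) ^ 2)⁻¹ := Finset.sum_le_sum step4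
    _ = 125 * (δ⁻¹ ^ 3 * R⁻¹ ^ 3) * ∑ b ∈ t, ((b : ℝ) ^ 2)⁻¹ := by rw [Finset.mul_sum]
    _ ≤ 125 * (δ⁻¹ ^ 3 * R⁻¹ ^ 3) * 2 := mul_le_mul_of_nonneg_left step5 (by positivity)
    _ = 250 * (δ⁻¹ ^ 3 * R⁻¹ ^ 3) := by ring

end Summit.AtomisticToContinuum.Crystallization.Theorems.PhononSlackCertificatesFarFieldGapR

end
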